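import Summits.HodgeConjecture.CorCM.AbelianTwoPowerThinKernel
import HarnessLib

/-!
# Abelian groups of order `16` in which every square is `1` or `ρ`: a CM type equidistributed over an odd
# character has a non-trivial stabiliser (the two sporadic "good" pairs `(ℤ/2)⁴` and `ℤ/4 × (ℤ/2)²`, `ρ` a square)

COR-CM (cell `pub-hodgecm2`), binder seat b04 (gen 15), count-neutral claim ABELIAN-2POWER-CLASSIF, part IIa (pure
group theory; the number fields are in part IIb `CorCM/AbelianSixteenSquaresInConj`).  KERNEL ONLY: theorems; no
definition, no named fact, no `sorry`.

Setting (as in part Ia `CorCM/AbelianTwoPowerThinKernel`): `G` commutative, `ρ ∈ G` ("complex conjugation"),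
`T ⊆ G` a CM type (`ρg ∈ T ↔ g ∉ T`), `χ` an odd character (`χ(ρ) = −1`) over which `T` is EQUIDISTRIBUTED
(`#{t ∈ T : χ(t) = χ(g)} = #{t ∈ T : χ(t) = −χ(g)}` for all `g`).  Assume `|G| = 16` and **every square is `1` or
`ρ`** (the abelian pairs `((ℤ/2)⁴, any ρ)` and `(ℤ/4 × (ℤ/2)², ρ = (2,0,0))`).  Then `χ(g)² = χ(g²) = ±1`, so either

* (A) `χ = ±1` everywhere: `H = ker χ` has index `2`, is an elementary abelian `2`-group of order `8`, and
  `A = T ∩ H` has `4` elements (`exists_stabiliser_of_sign_character`).  THE `F₂³`-LEMMA (`four_subset_dichotomy`): for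
  `A = {a,b,d,e} ⊆ H` with `s = abde`, either `s = 1` and `u = ab ≠ 1` satisfies `uA = A`, or `s ≠ 1` and
  `sA ∩ A = ∅` (whence `sA = H ∖ A`).  In the first case `u`, in the second `ρs`, stabilises `T`.
* (B) some `χ(γ) = ω` with `ω² = −1`: `H = ker χ` has order `4`, the fibres of `χ` are `H, γH, ρH, ργH`, and
  `A₀ = T ∩ H`, `A₁ = {h ∈ H : γh ∈ T}` are `2`-subsets `{a,b}`, `{d,e}` of the Klein group `H`
  (`exists_stabiliser_of_order_four_value`).  If `ab = de = u` then `u` stabilises `T`; otherwise `x = ab·de`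
  exchanges each `Aᵢ` with `H ∖ Aᵢ` and `ρx` stabilises `T`.

Main statement: `exists_stabiliser_sixteen`.  With part Ia this says: NO primitive CM type of such a `(G, ρ)` is
degenerate — the two order-`16` exceptions to "complex conjugation must lie in a cyclic subgroup of index `≤ 2`"
(offline census of this seat over all abelian `(G, ρ)` with `|G| ≤ 32`: `(ℤ/2)⁴` has `128` primitive types, all of
rank `9`; `ℤ/4 × (ℤ/2)²` with `ρ = (2,0,0)` has `192`, all of rank `9`; whereas `(ℤ/2)⁵` has `26880` primitive
types of rank `11 < 17` and `ℤ/4 × (ℤ/2)³`, `ρ = (2,0,0,0)`, has `12544` degenerate ones — the hypothesis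
`|G| = 16` is sharp).  The `F₂³`-lemma is the familiar fact that a `4`-subset of `F₂³` is an affine plane or an
affine frame `{p, p+x, p+y, p+z}` whose complement is its translate by `x+y+z`.

## References

* [Kubota1965] T. Kubota, *On the field extension by complex multiplication*, Trans. AMS 118 (1965), §4 Lemma 2.
* [Dodson1984] B. Dodson, *The structure of Galois groups of CM-fields*, Trans. AMS 283 (1984), §3.1.1, §5.2.
* [Shimura1998] G. Shimura, *Abelian Varieties with Complex Multiplication and Modular Functions*, §8.2 Prop. 26.
-/

noncomputable section

namespace Summit.HodgeConjecture.CorCM.AbelianSixteen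

open Summit.HodgeConjecture.CorCM.ThinKernel (chi_eq_iff neg_chi_eq)

variable {G : Type*} [CommGroup G] [Fintype G] [DecidableEq G]

/-! ## §1 Generalities: the size of a CM type, the kernel of a character, squares -/

omit [DecidableEq G] in
/-- A CM type is half of the group: `2·|T| = |G|` (`g ↦ ρg` is a bijection `G ∖ T → T`). [cite: Shimura1998, §18.1] -/
theorem two_mul_card_eq [DecidableEq G] {ρ : G} {T : Finset G} (hT : ∀ g : G, ρ * g ∈ T ↔ g ∉ T)
    (hρ2 : ρ * ρ = 1) : 2 * T.card = Fintype.card G := by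
  have hbij : Tᶜ.card = T.card := by
    refine Finset.card_bij (fun g _ => ρ * g) (fun g hg => (hT g).2 (Finset.mem_compl.1 hg))
      (fun a _ b _ h => mul_left_cancel h) (fun t ht => ⟨ρ * t, ?_, ?_⟩)
    · rw [Finset.mem_compl]
      exact fun h => (hT t).1 h ht
    · rw [← mul_assoc, hρ2, one_mul]
  have h := Finset.card_compl T
  rw [hbij] at h
  have hle : T.card ≤ Fintype.card G := Finset.card_le_univ T
  omega

omit [Fintype G] [DecidableEq G] in
/-- The kernel of a character of `G`, as a subgroup. [folklore] -/
theorem exists_ker (χ : AddChar (Additive G) ℂ) :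
    ∃ H : Subgroup G, ∀ g, g ∈ H ↔ χ (Additive.ofMul g) = 1 :=
  ⟨{ carrier := {g | χ (Additive.ofMul g) = 1}
     mul_mem' := fun {a b} ha hb => by
       simp only [Set.mem_setOf_eq] at ha hb ⊢
       rw [ofMul_mul, AddChar.map_add_eq_mul, ha, hb, one_mul]
     one_mem' := by simp only [Set.mem_setOf_eq, ofMul_one, AddChar.map_zero_eq_one]
     inv_mem' := fun {a} ha => by
       simp only [Set.mem_setOf_eq] at ha ⊢
       rw [ofMul_inv, AddChar.map_neg_eq_inv, ha, inv_one] }, fun _ => Iff.rfl⟩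

omit [Fintype G] [DecidableEq G] in
/-- `χ(g)² = χ(g²)`. [folklore] -/
theorem chi_sq (χ : AddChar (Additive G) ℂ) (g : G) :
    χ (Additive.ofMul g) ^ 2 = χ (Additive.ofMul (g * g)) := by
  rw [ofMul_mul, AddChar.map_add_eq_mul, pow_two]

omit [Fintype G] [DecidableEq G] in
/-- If every square is `1` or `ρ` and `χ(ρ) = −1`, then `χ(g)² = ±1`; and `χ(g)² = 1` forces `g² = 1`.
[folklore] -/
theorem sq_eq_one_of_chi_sq {ρ : G} (hsq : ∀ g : G, g * g = 1 ∨ g * g = ρ) (χ : AddChar (Additive G) ℂ)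
    (hχ : χ (Additive.ofMul ρ) = -1) {g : G} (h : χ (Additive.ofMul g) ^ 2 = 1) : g * g = 1 := by
  rcases hsq g with h1 | h2
  · exact h1
  · rw [chi_sq, h2, hχ] at h
    norm_num at h

/-! ## §2 The `F₂³`-lemma and the `F₂²`-lemma -/

omit [Fintype G] in
/-- **The `F₂³`-lemma.**  Let `A` be a `4`-subset of a commutative group consisting of involutions
(`x² = 1`), `s = ∏_{x∈A} x`.  Either `s = 1`, and then `u = ab ≠ 1` (for any two distinct `a, b ∈ A`) maps `A` to
itself; or `s ≠ 1`, and then `sA ∩ A = ∅` (if `sx = y` with `x, y ∈ A` then `x ≠ y` and the other two elements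
`p, q` of `A` satisfy `pq = 1`, `p = q`).  (A `4`-subset of `F₂³` is an affine plane or an affine frame.) [folklore] -/
theorem four_subset_dichotomy (A : Finset G) (hA : A.card = 4) (hinv : ∀ x ∈ A, x * x = 1) :
    (∃ u : G, u ≠ 1 ∧ u * u = 1 ∧ ∀ z ∈ A, u * z ∈ A) ∨
      ((∏ x ∈ A, x) ≠ 1 ∧ ∀ z ∈ A, (∏ x ∈ A, x) * z ∉ A) := by
  have hinv' : ∀ x ∈ A, x⁻¹ = x := fun x hx => inv_eq_of_mul_eq_one_right (hinv x hx)
  -- decomposition `A = {x, y} ⊔ {p, q}` around any two distinct elements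
  have hdec : ∀ x ∈ A, ∀ y ∈ A, x ≠ y → ∃ p q : G, p ≠ q ∧ p ∈ A ∧ q ∈ A ∧ p ≠ x ∧ p ≠ y ∧ q ≠ x ∧ q ≠ y ∧
      (∏ z ∈ A, z) = x * y * (p * q) ∧ ∀ z ∈ A, z = x ∨ z = y ∨ z = p ∨ z = q := by
    intro x hx y hy hxy
    have hy' : y ∈ A.erase x := Finset.mem_erase.2 ⟨hxy.symm, hy⟩
    have hcard : ((A.erase x).erase y).card = 2 := by
      rw [Finset.card_erase_of_mem hy', Finset.card_erase_of_mem hx, hA]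
    obtain ⟨p, q, hpq, hpqe⟩ := Finset.card_eq_two.1 hcard
    have hp : p ∈ (A.erase x).erase y := by rw [hpqe]; exact Finset.mem_insert_self p {q}
    have hq : q ∈ (A.erase x).erase y := by rw [hpqe]; simp
    simp only [Finset.mem_erase] at hp hq
    refine ⟨p, q, hpq, hp.2.2, hq.2.2, hp.2.1, hp.1, hq.2.1, hq.1, ?_, fun z hz => ?_⟩
    · rw [← Finset.insert_erase hx, Finset.prod_insert (Finset.notMem_erase x A),
        ← Finset.insert_erase hy', Finset.prod_insert (Finset.notMem_erase y _), hpqe, Finset.prod_pair hpq,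
        mul_assoc]
    · by_cases hzx : z = x
      · exact Or.inl hzx
      by_cases hzy : z = y
      · exact Or.inr (Or.inl hzy)
      have : z ∈ (A.erase x).erase y := Finset.mem_erase.2 ⟨hzy, Finset.mem_erase.2 ⟨hzx, hz⟩⟩
      rw [hpqe, Finset.mem_insert, Finset.mem_singleton] at this
      exact Or.inr (Or.inr this)
  by_cases hs : (∏ x ∈ A, x) = 1
  · -- `s = 1`: `u = xy` permutes `A = {x, y, p, q}` (`pq = (xy)⁻¹ = xy`)
    left
    obtain ⟨x, hx, y, hy, hxy⟩ : ∃ x ∈ A, ∃ y ∈ A, x ≠ y := by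
      have h1 : 1 < A.card := by rw [hA]; norm_num
      obtain ⟨x, hx, y, hy, hxy⟩ := Finset.one_lt_card.1 h1
      exact ⟨x, hx, y, hy, hxy⟩
    obtain ⟨p, q, hpq, hp, hq, hpx, hpy, hqx, hqy, hprod, hcover⟩ := hdec x hx y hy hxy
    have hxx := hinv x hx; have hyy := hinv y hy; have hpp := hinv p hp; have hqq := hinv q hq
    have hpqxy : p * q = x * y := by
      rw [hs] at hprod
      -- `1 = xy·pq` ⟹ `pq = (xy)⁻¹ = xy`
      rw [eq_inv_of_mul_eq_one_right hprod.symm, mul_inv, hinv' x hx, hinv' y hy]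
    refine ⟨x * y, fun h => hxy ?_, by rw [mul_mul_mul_comm, hxx, hyy, one_mul], fun z hz => ?_⟩
    · rw [← hinv' y hy]; exact eq_inv_of_mul_eq_one_left h
    rcases hcover z hz with h | h | h | h <;> rw [h]
    · rw [mul_comm x y, mul_assoc, hxx, mul_one]; exact hy
    · rw [mul_assoc, hyy, mul_one]; exact hx
    · rw [← hpqxy, mul_comm p q, mul_assoc, hpp, mul_one]; exact hq
    · rw [← hpqxy, mul_assoc, hqq, mul_one]; exact hp
  · -- `s ≠ 1`: `sA ∩ A = ∅`
    right
    refine ⟨hs, fun z hz hsz => ?_⟩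
    set s := ∏ x ∈ A, x with hs_def
    by_cases hzz : s * z = z
    · exact hs (mul_right_cancel (b := z) (by rw [hzz, one_mul]))
    -- `y = sz ≠ z`, both in `A`; the other two elements `p, q` have `pq = 1`
    obtain ⟨p, q, hpq, hp, hq, -, -, -, -, hprod, -⟩ := hdec z hz (s * z) hsz (Ne.symm hzz)
    have hzinv := hinv z hz
    -- `s = z (sz) (pq) = s (z z) (p q) = s (p q)` ⟹ `pq = 1` ⟹ `p = q`
    have hpq1 : p * q = 1 := by
      have h : s = s * (p * q) := by
        conv_lhs => rw [hprod]
        rw [mul_left_comm z s z, hzinv, mul_one]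
      exact mul_left_cancel (a := s) (by rw [← h, mul_one])
    exact hpq (by rw [← hinv' q hq]; exact eq_inv_of_mul_eq_one_left hpq1)

omit [Fintype G] in
/-- **The `F₂²`-lemma.**  A `2`-subset `A = {a, b}` of involutions: `u = ab ≠ 1` maps `A` to itself, and any
`x ∉ {1, u}` maps `A` off itself. [folklore] -/
theorem two_subset_stabiliser (A : Finset G) (hA : A.card = 2) (hinv : ∀ x ∈ A, x * x = 1) :
    ∃ u : G, u ≠ 1 ∧ u * u = 1 ∧ (∀ z ∈ A, u * z ∈ A) ∧ ∀ x : G, x ≠ 1 → x ≠ u → ∀ z ∈ A, x * z ∉ A := by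
  obtain ⟨a, b, hab, rfl⟩ := Finset.card_eq_two.1 hA
  have ha : a * a = 1 := hinv a (by simp)
  have hb : b * b = 1 := hinv b (by simp)
  have hainv : a⁻¹ = a := inv_eq_of_mul_eq_one_right ha
  have hbinv : b⁻¹ = b := inv_eq_of_mul_eq_one_right hb
  refine ⟨a * b, fun h => hab ?_, by rw [mul_mul_mul_comm, ha, hb, one_mul], fun z hz => ?_,
    fun x hx1 hxu z hz hxz => ?_⟩
  · rw [← hbinv]; exact eq_inv_of_mul_eq_one_left h
  · simp only [Finset.mem_insert, Finset.mem_singleton] at hz ⊢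
    rcases hz with rfl | rfl
    · exact Or.inr (by rw [mul_comm z b, mul_assoc, ha, mul_one])
    · exact Or.inl (by rw [mul_assoc, hb, mul_one])
  · simp only [Finset.mem_insert, Finset.mem_singleton] at hz hxz
    rcases hz with rfl | rfl <;> rcases hxz with h | h
    · exact hx1 (mul_right_cancel (b := z) (by rw [h, one_mul]))
    · exact hxu (by rw [← mul_right_cancel_iff (a := z), mul_comm z b, mul_assoc, ha, mul_one]; exact h)
    · exact hxu (by
        have : x = a * z⁻¹ := eq_mul_inv_of_mul_eq h
        rw [this, hbinv])
    · exact hx1 (mul_right_cancel (b := z) (by rw [h, one_mul]))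

/-! ## §3 Case (A): the character takes only the values `±1` -/

omit [DecidableEq G] in
/-- **Case (A).**  `|G| = 16`, squares in `{1, ρ}`, `χ = ±1` everywhere, `T` a CM type equidistributed over `χ`:
then some `v ≠ 1` stabilises `T`.  (`A = T ∩ ker χ` is a `4`-subset of the elementary abelian group `ker χ` of
order `8`; apply the `F₂³`-lemma: `u` resp. `ρs` stabilises `T`.) [cite: Kubota1965, §4 Lemma 2] -/
theorem exists_stabiliser_of_sign_character [DecidableEq G] {ρ : G} {T : Finset G}
    (hT : ∀ g : G, ρ * g ∈ T ↔ g ∉ T) (hρ2 : ρ * ρ = 1) (hG : Fintype.card G = 16)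
    (hsq : ∀ g : G, g * g = 1 ∨ g * g = ρ) (χ : AddChar (Additive G) ℂ) (hχ : χ (Additive.ofMul ρ) = -1)
    (hval : ∀ g : G, χ (Additive.ofMul g) = 1 ∨ χ (Additive.ofMul g) = -1)
    (hE : ∀ g : G, (T.filter fun s => χ (Additive.ofMul s) = χ (Additive.ofMul g)).card =
        (T.filter fun s => χ (Additive.ofMul s) = -χ (Additive.ofMul g)).card) :
    ∃ v : G, v ≠ 1 ∧ ∀ z : G, z ∈ T ↔ v * z ∈ T := by
  obtain ⟨H, hH⟩ := exists_ker χ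
  set A : Finset G := T.filter fun s => χ (Additive.ofMul s) = 1 with hA_def
  have hmemA : ∀ z, z ∈ A ↔ z ∈ T ∧ χ (Additive.ofMul z) = 1 := fun z => Finset.mem_filter
  -- involutions in the kernel
  have hinvH : ∀ x, χ (Additive.ofMul x) = 1 → x * x = 1 := fun x hx =>
    sq_eq_one_of_chi_sq hsq χ hχ (by rw [hx, one_pow])
  -- `|T| = 8`, `|A| = 4`
  have hT8 : T.card = 8 := by have := two_mul_card_eq hT hρ2; omega
  have hA4 : A.card = 4 := by
    have h1 := hE 1
    rw [ofMul_one, AddChar.map_zero_eq_one] at h1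
    have hsplit := Finset.card_filter_add_card_filter_not (s := T) (fun s => χ (Additive.ofMul s) = 1)
    have hneg : (T.filter fun s => ¬χ (Additive.ofMul s) = 1) = T.filter fun s => χ (Additive.ofMul s) = -1 := by
      refine Finset.filter_congr fun s _ => ⟨fun h => (hval s).resolve_left h, fun h h1 => ?_⟩
      rw [h1] at h; norm_num at h
    rw [hneg, ← h1, hT8] at hsplit
    change A.card + A.card = 8 at hsplit
    omega
  -- membership bookkeeping: for `z ∉ ker χ`, `ρz ∈ ker χ`
  have hρval : ∀ z, χ (Additive.ofMul z) = -1 → χ (Additive.ofMul (ρ * z)) = 1 := fun z hz => by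
    rw [← neg_chi_eq χ hχ, hz, neg_neg]
  rcases four_subset_dichotomy A hA4 (fun x hx => hinvH x ((hmemA x).1 hx).2) with
    ⟨u, hu1, huu, huA⟩ | ⟨hs1, hsA⟩
  · -- `u ∈ ker χ` (it is a product of two elements of `A`, but we only need: `u·A = A` ⟹ `χ(u) = 1`)
    obtain ⟨a, ha⟩ : ∃ a, a ∈ A := Finset.card_pos.1 (by rw [hA4]; norm_num)
    have hχu : χ (Additive.ofMul u) = 1 := by
      have h1 := ((hmemA _).1 (huA a ha)).2
      rw [ofMul_mul, AddChar.map_add_eq_mul, ((hmemA a).1 ha).2, mul_one] at h1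
      exact h1
    refine ⟨u, hu1, fun z => ?_⟩
    -- it suffices to prove `z ∈ T → uz ∈ T` (then apply to `uz`, `u² = 1`)
    suffices key : ∀ z, z ∈ T → u * z ∈ T by
      refine ⟨key z, fun h => ?_⟩
      have := key _ h
      rwa [← mul_assoc, huu, one_mul] at this
    intro z hz
    rcases hval z with h1 | h2
    · exact ((hmemA _).1 (huA z ((hmemA z).2 ⟨hz, h1⟩))).1
    · -- `z = ρ h` with `h = ρ z ∈ ker χ ∖ T`; `u z ∈ T ↔ u h ∉ T`
      have hh : ρ * z ∉ T := fun h => (hT z).1 h hz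
      have huh : u * (ρ * z) ∉ T := fun h => by
        have hmem : u * (ρ * z) ∈ A := (hmemA _).2 ⟨h, by
          rw [ofMul_mul, AddChar.map_add_eq_mul, hχu, hρval z h2, one_mul]⟩
        have := huA _ hmem
        rw [← mul_assoc, huu, one_mul] at this
        exact hh ((hmemA _).1 this).1
      have : ρ * (u * (ρ * z)) ∈ T := (hT _).2 huh
      rwa [mul_left_comm, ← mul_assoc ρ ρ z, hρ2, one_mul] at this
  · -- `s ∉ {1}`, `sA ∩ A = ∅`; `s ∈ ker χ`, `s² = 1`; `v = ρ s`
    set s : G := ∏ x ∈ A, x with hs_def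
    have hsH : s ∈ H := H.prod_mem fun x hx => (hH x).2 ((hmemA x).1 hx).2
    have hχs : χ (Additive.ofMul s) = 1 := (hH s).1 hsH
    have hss : s * s = 1 := hinvH s hχs
    -- the kernel has `8` elements, `A` and `ker χ ∖ A` have `4` each; so `s(ker ∖ A) ⊆ A`
    set Hf : Finset G := Finset.univ.filter fun g => χ (Additive.ofMul g) = 1 with hHf_def
    have hHf8 : Hf.card = 8 := by
      have hsplit := Finset.card_filter_add_card_filter_not (s := (Finset.univ : Finset G))
        (fun g => χ (Additive.ofMul g) = 1)
      have hbij : (Finset.univ.filter fun g : G => ¬χ (Additive.ofMul g) = 1).card = Hf.card := by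
        refine Finset.card_bij (fun g _ => ρ * g) (fun g hg => ?_) (fun a _ b _ h => mul_left_cancel h)
          (fun g hg => ⟨ρ * g, ?_, by rw [← mul_assoc, hρ2, one_mul]⟩)
        · simp only [Finset.mem_filter, Finset.mem_univ, true_and, hHf_def] at hg ⊢
          exact hρval g ((hval g).resolve_left hg)
        · simp only [Finset.mem_filter, Finset.mem_univ, true_and, hHf_def] at hg ⊢
          rw [ofMul_mul, AddChar.map_add_eq_mul, hχ, hg]; norm_num
      rw [hbij, Finset.card_univ, hG] at hsplit
      change Hf.card + Hf.card = 16 at hsplit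
      omega
    have hAsub : A ⊆ Hf := fun x hx => by
      simp only [hHf_def, Finset.mem_filter, Finset.mem_univ, true_and]; exact ((hmemA x).1 hx).2
    -- `sA = Hf \ A`
    have hsA_eq : A.image (fun x => s * x) = Hf \ A := by
      apply Finset.eq_of_subset_of_card_le
      · intro y hy
        obtain ⟨x, hx, rfl⟩ := Finset.mem_image.1 hy
        rw [Finset.mem_sdiff]
        refine ⟨?_, hsA x hx⟩
        simp only [hHf_def, Finset.mem_filter, Finset.mem_univ, true_and]
        rw [ofMul_mul, AddChar.map_add_eq_mul, hχs, ((hmemA x).1 hx).2, one_mul]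
      · rw [Finset.card_sdiff_of_subset hAsub, hHf8, hA4, Finset.card_image_of_injective _ (mul_right_injective s),
          hA4]
    have hsHA : ∀ h, χ (Additive.ofMul h) = 1 → h ∉ A → s * h ∈ A := by
      intro h hh hhA
      have hmem : h ∈ Hf \ A := Finset.mem_sdiff.2 ⟨by
        simp only [hHf_def, Finset.mem_filter, Finset.mem_univ, true_and]; exact hh, hhA⟩
      rw [← hsA_eq] at hmem
      obtain ⟨x, hx, hxh⟩ := Finset.mem_image.1 hmem
      rw [← hxh, ← mul_assoc, hss, one_mul]
      exact hx
    refine ⟨ρ * s, fun h => ?_, fun z => ?_⟩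
    · -- `ρ s = 1` ⟹ `χ(ρ) χ(s) = 1` ⟹ `-1 = 1`
      have : χ (Additive.ofMul (ρ * s)) = 1 := by rw [h, ofMul_one, AddChar.map_zero_eq_one]
      rw [ofMul_mul, AddChar.map_add_eq_mul, hχ, hχs] at this
      norm_num at this
    have hvv : ρ * s * (ρ * s) = 1 := by rw [mul_mul_mul_comm, hρ2, hss, one_mul]
    suffices key : ∀ z, z ∈ T → ρ * s * z ∈ T by
      refine ⟨key z, fun h => ?_⟩
      have := key _ h
      rwa [← mul_assoc, hvv, one_mul] at this
    intro z hz
    rcases hval z with h1 | h2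
    · -- `z ∈ A`, `sz ∈ ker ∖ A`, so `sz ∉ T` and `ρ s z ∈ T`
      have hzA : z ∈ A := (hmemA z).2 ⟨hz, h1⟩
      have hszT : s * z ∉ T := fun h => hsA z hzA ((hmemA _).2 ⟨h, by
        rw [ofMul_mul, AddChar.map_add_eq_mul, hχs, h1, one_mul]⟩)
      rw [mul_assoc]
      exact (hT _).2 hszT
    · -- `z = ρh`, `h ∈ ker ∖ T`, so `h ∉ A`, `sh ∈ A ⊆ T`, and `ρ s z = s h`
      have hh : ρ * z ∉ T := fun h => (hT z).1 h hz
      have hshA := hsHA (ρ * z) (hρval z h2) (fun h => hh ((hmemA _).1 h).1)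
      rw [show ρ * s * z = s * (ρ * z) by rw [mul_comm ρ s, mul_assoc]]
      exact ((hmemA _).1 hshA).1

end Summit.HodgeConjecture.CorCM.AbelianSixteen

end
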